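import Summits.QuantumFields.YangMills.Theorems.LuscherReductionTwistedTraceScalingTrackStub
import Summits.QuantumFields.YangMills.Theorems.LuscherReductionTwistedTraceScalingTowerE1Converse
import Summits.QuantumFields.YangMills.Theorems.TwistedTraceScaling.Negative.TowerE1NonUniformOfFemtoTraceLaw
import Summits.QuantumFields.YangMills.Theorems.TwistedTraceScaling.Negative.ClockRobustness
import HarnessLib

/-!
# `TwistedTraceScaling` (crux stmt-QuantumFields-20203, route `LuscherReduction`, skeleton «twolattice» REV 3 «TWO-LOOP CALIBRATION»,
# sha16 1a2ae9b1ae61a9c5): negative-side support VII — with TRACK landed (p548356) the XL stub CMP-2LOOP `Stmt.stub_cmpTwoLoop` is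
# EQUIVALENT, modulo S-BASE, to the uniform femto trace law UFTL, hence to rev 2's TOWER-E1 and rev 1's S-TOWER, and its calibrator
# interface `∀ φ, twoLoopLawH … φ → …` carries no content modulo S-BASE («for every calibrator» ⟺ «for some calibrator»)
# (refuter crux-disprover seat, cycle 5; this file does NOT refute the crux or any registered stub)

HONEST FRAMING: `TwistedTraceScaling` is a femto-rung (R2b1) crux of a CONDITIONAL reduction route; nothing here is a mass-gap or Clay
statement; CMP-2LOOP, UFTL, TOWER-E1 and S-BASE all remain OPEN.  Rev 3 (owner ym-beyond-p1 g29) registers S-BASE `stub_fixedLatticeTraceLaw`,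
CMP-2LOOP `stub_cmpTwoLoop` (XL) and TRACK `stub_labelTracking`; TRACK is a tree theorem (`TwoLattice.stub_labelTracking`, LEAD g1, p548356) and
the stub texts are tree abbreviations (`TwoLattice.Stmt.*`, p544847).  This file settles the LOGICAL POSITION of the remaining XL stub:

* §1 `exists_twoLoopLawH` (a Markov calibrator obeys the two-loop law at every `M ≥ 2`); `towerE1_of_cmpTwoLoop` — CMP-2LOOP ALONE implies
  rev 2's registered TOWER-E1 text (the skeleton's `towerE1_of_cmp_of_tracking`, TRACK discharged by the tree theorem); hence
  `uniform_of_cmpTwoLoop_of_base` — CMP-2LOOP ∧ S-BASE ⇒ UFTL (tree `Tower.uniform_of_towerE1_of_base`).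
* §2 the femto-time sandwich `steps_sandwich`: a time extent `T` pinned to femto time `s` within `δ ≤ ηs/8` by ANY clock value that also pins
  the label's own `femtoSteps s β L` within `δ` lies between `femtoSteps ((1∓η)s) β L` once the femto unit `Λ/L ≤ ηs/4` (pure arithmetic).
* §3 ★ `cmpTwoLoop_of_uniform_of_base` — UFTL ∧ S-BASE ⇒ CMP-2LOOP for EVERY two-loop calibrator: `η` from the continuity of `r_𝔥` at `s`
  (`continuousAt_hTraceRatio`), `M² ≥` the UFTL thresholds at the times `(1∓η)s`, `δ = ηs/8`; for a calibrator `φ`, `lam0 ≤` TRACK's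
  `lam1(M, δ, s, φ)`, the UFTL depths, `ηs/8`, `1/2` and `1/(8(1+δ)B)` with `B ≥` the S-BASE thresholds of the bases `b < M²` (the calibrated
  `β₁ ≥ x̂/(2(1+δ)) ≥ 1/(8(1+δ)lam³) ≥ B`); a label-matched `β₁' ≥ 1` on `b` exists (`Tower.exists_matched`), so TRACK (iii) pins `femtoSteps s β L`
  in calibrated units, §2 sandwiches the given `T`, and monotonicity of `r(L, β, ·)` (`traceRatio_mono`) with UFTL at `(1∓η)s` puts the fine
  ratio within `ε/2` of `r_𝔥(s)`; S-BASE puts the base ratio within `ε/2`.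
* §4 corollaries modulo S-BASE: `cmpTwoLoop_iff_uniform_of_base` (⟺ UFTL), `cmpTwoLoop_iff_towerE1_of_base` (⟺ rev 2's TOWER-E1),
  `cmpTwoLoop_iff_twoLatticeUniversality_of_base` (⟺ rev 1's S-TOWER), ★ `cmpTwoLoop_of_cmpSome_of_base` (SOME lawful calibrator ⇒ EVERY one).

DESIGN CONSEQUENCES (disprover's reading): (a) rev 3's re-typing on calibrated data is CURRENCY, not content — modulo S-BASE the XL stubs of
revs 1, 2, 3 coincide (kernel-checked here), so every negative lemma about UFTL / S-TOWER / TOWER-E1 transfers to CMP-2LOOP; (b) the calibrator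
`φ` is DECORATION modulo S-BASE: a proof may fix the friendliest lawful calibrator (e.g. the Markov family), a refutation must refute UFTL itself —
no junk / kicked / off-box calibrator can bite (closing the cycle-4 junk-model hazard for this stub); (c) CMP-2LOOP's coupling tolerance `δ·2β₁`,
free time extent `T` and calibrated clock `calLambda` ask NOTHING of the RG beyond UFTL: they are absorbed by TRACK + monotonicity + continuity
of `r_𝔥`.  No verdict on CMP-2LOOP itself (≡ UFTL mod S-BASE: believed true, not in print).
-/

set_option autoImplicit false

noncomputable section

open MeasureTheory Filter Topology Real
open Literature.MathematicalPhysics.QuantumFieldTheory hiding SU2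
open Literature.MathematicalPhysics.QuantumFieldTheory.Balaban1983to89
open scoped BigOperators

namespace Summit.QuantumFields.YangMills.Theorems.TwistedTraceScaling.Negative

open Summit.QuantumFields.YangMills.Theorems.FemtoTransferGap
open Summit.QuantumFields.YangMills.Theorems.FemtoTransferGap.TraceDoor
open Summit.QuantumFields.YangMills.Theorems.FemtoTransferGap.TwoLattice

namespace R3

/-! ## §1 A calibrator exists; CMP-2LOOP alone gives TOWER-E1; with S-BASE it gives UFTL -/

/-- The one-loop step `stepBal 2 M = 8b₀ log M` is positive and the two-loop step `32 b₁ log M` non-negative for `M ≥ 2`. [folklore] -/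
theorem steps_pos {M : ℕ} (hM : 2 ≤ M) : 0 < B12Normalization.stepBal 2 (M : ℝ) ∧ 0 ≤ twoLoopStepBal M := by
  have hb0 : 0 < b0 := by unfold b0; positivity
  have hb1 : 0 < b1 := by unfold b1; positivity
  have hM1 : (1 : ℝ) < M := by exact_mod_cast (lt_of_lt_of_le (by norm_num) hM : 1 < M)
  have hlog : 0 < Real.log (M : ℝ) := Real.log_pos hM1
  refine ⟨?_, ?_⟩
  · rw [Track.stepBal_two_eq M]; positivity
  · unfold twoLoopStepBal; positivity

/-- The MARKOV calibrator `φ_{k+1}(g_0,…,g_k) = binf + b1inf·g_k²` (`binf > 0`, `b1inf ≥ 0`) obeys the skeleton's two-loop law, i.e. the tree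
abbreviation `Stmt.twoLoopLawH binf b1inf φ` (`γ = 1`, `b = binf`, `C₁ = b1inf`, `c₀ = C₃ = c₁ = θ₁ = 0`, `θ₀ = 1/2`, `k₀ = 1`); it is the member `c = 0`
of the kicked family of `R3.twoLoopLawH_kicked` (module `…Negative.TwoLoopCalibrationGuards`, which states the law's body verbatim) and the
skeleton's own `twoLoopLawH_markov`. [cite: Balaban1987RG1, (0.20) p.256, Thm 2 p.259] -/
theorem twoLoopLawH_markov {binf b1inf : ℝ} (hbinf : 0 < binf) (hb1 : 0 ≤ b1inf) (φ : FlowStep.HBeta)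
    (hφ : ∀ (k : ℕ) (p : Fin (k + 1) → ℝ), φ k p = binf + b1inf * p (Fin.last k) ^ 2) : Stmt.twoLoopLawH binf b1inf φ := by
  let S : B12Beta.OneLoopSplit φ :=
    { β0 := fun _ => binf
      β1 := fun k p => b1inf * p (Fin.last k) ^ 2
      split := fun k p => hφ k p
      vanish := fun k p hp => by simp [hp] }
  unfold Stmt.twoLoopLawH
  refine ⟨S, 1, binf, b1inf, 0, 1 / 2, 0, 0, 0, 1, one_pos, hbinf, hb1, le_rfl, by norm_num, by norm_num, le_rfl, le_rfl,
    le_rfl, one_pos, ?_, ?_, ?_, ?_⟩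
  · intro k v _ _
    rw [hφ]
    nlinarith [mul_nonneg hb1 (sq_nonneg (v (Fin.last k)))]
  · intro k
    show |binf - binf| ≤ 0 * (1 / 2) ^ k
    simp
  · intro k p hp
    have h := (FlowStep.mem_box.1 hp) (Fin.last k)
    show |b1inf * p (Fin.last k) ^ 2| ≤ b1inf * p (Fin.last k)
    rw [abs_of_nonneg (by positivity)]
    nlinarith [mul_nonneg hb1 h.1.le, h.2]
  · intro K gs _ _ k _
    show |b1inf * (FlowStep.prefixOf gs k) (Fin.last k) ^ 2 - b1inf * gs k ^ 2| ≤ 0 * gs k ^ 3 + 0 * (0 : ℝ) ^ k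
    simp [FlowStep.prefixOf]

/-- **A two-loop calibrator exists at every block factor `M ≥ 2`**: the Markov family with `binf = stepBal 2 M = 8b₀ log M > 0` and
`b1inf = 32 b₁ log M ≥ 0` (the skeleton's `exists_twoLoopLawH`). [folklore] -/
theorem exists_twoLoopLawH {M : ℕ} (hM : 2 ≤ M) :
    ∃ φ : FlowStep.HBeta, Stmt.twoLoopLawH (B12Normalization.stepBal 2 M) (twoLoopStepBal M) φ := by
  obtain ⟨hbinf, hb1inf⟩ := steps_pos hM
  exact ⟨fun k p => B12Normalization.stepBal 2 (M : ℝ) + twoLoopStepBal M * p (Fin.last k) ^ 2,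
    twoLoopLawH_markov hbinf hb1inf _ (fun k p => rfl)⟩

/-- ★ **CMP-2LOOP alone implies rev 2's registered TOWER-E1 text** (the skeleton's `towerE1_of_cmp_of_tracking` with TRACK discharged by the
tree theorem `TwoLattice.stub_labelTracking`, p548356): pick the Markov calibrator at CMP's `M`, shrink the depth to `min lam0 lam1`, and feed
TRACK's three calibrated outputs at the label-matched pair into CMP-2LOOP at `T = femtoSteps s β L`. [folklore] -/
theorem towerE1_of_cmpTwoLoop (hC : Stmt.stub_cmpTwoLoop) :
    ∀ s : ℝ, 0 < s → ∀ ε : ℝ, 0 < ε → ∃ M : ℕ, 2 ≤ M ∧ ∃ lam0 : ℝ, 0 < lam0 ∧ ∀ lam : ℝ, 0 < lam → lam ≤ lam0 →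
      ∀ (L : ℕ) [NeZero L], M ^ 2 ≤ L → ∀ β : ℝ, InFemtoWindow lam β L →
        ∀ (b k : ℕ) [NeZero b], M ≤ b → b < M ^ 2 → b * M ^ (k + 1) ≤ L → L < b * M ^ k * (M + 1) →
          ∀ β₁ : ℝ, 1 ≤ β₁ → invRunningCoupling β₁ b = invRunningCoupling β L →
            |traceRatio L β (femtoSteps s β L) - traceRatio b β₁ (femtoSteps s β₁ b)| ≤ ε := by
  intro s hs ε hε
  obtain ⟨M, hM, δ, hδ, hcmp⟩ := hC s hs ε hε
  obtain ⟨φ, hφ⟩ := exists_twoLoopLawH hM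
  obtain ⟨lam0, hlam0, hc⟩ := hcmp φ hφ
  obtain ⟨lam1, hlam1, ht⟩ := TwoLattice.stub_labelTracking M hM δ hδ s hs φ hφ
  refine ⟨M, hM, min lam0 lam1, lt_min hlam0 hlam1, ?_⟩
  intro lam hlam hle L _ hL β hW b k _ hMb hbM hkL hLk β₁ hβ₁ hmatch
  obtain ⟨hwin, hmis, htime⟩ := ht lam hlam (hle.trans (min_le_right _ _)) L hL β hW b k hMb hbM hkL hLk β₁ hβ₁ hmatch
  exact hc lam hlam (hle.trans (min_le_left _ _)) L hL β hW b k hMb hbM hkL hLk hwin β₁ hβ₁ hmis (femtoSteps s β L) htime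

/-- **CMP-2LOOP ∧ S-BASE ⇒ UFTL** (the `lam`-uniform femto trace law; tree `Tower.uniform_of_towerE1_of_base` after `towerE1_of_cmpTwoLoop`).
Hypotheses = the registered texts `Stmt.stub_cmpTwoLoop` and (verbatim body of) `Stmt.stub_fixedLatticeTraceLaw`. [folklore] -/
theorem uniform_of_cmpTwoLoop_of_base (hC : Stmt.stub_cmpTwoLoop)
    (hBASE : ∀ (L1 : ℕ) [NeZero L1] (s : ℝ), 0 < s → ∀ ε : ℝ, 0 < ε → ∃ β1 : ℝ, ∀ β : ℝ, β1 ≤ β →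
      |traceRatio L1 β (femtoSteps s β L1) - hTraceRatio s| ≤ ε) :
    ∀ s : ℝ, 0 < s → ∀ ε : ℝ, 0 < ε → ∃ L0 : ℕ, ∃ lam0 : ℝ, 0 < lam0 ∧ ∀ lam : ℝ, 0 < lam → lam ≤ lam0 →
      ∀ (L : ℕ) [NeZero L], L0 ≤ L → ∀ β : ℝ, InFemtoWindow lam β L →
        |traceRatio L β (femtoSteps s β L) - hTraceRatio s| ≤ ε :=
  Tower.uniform_of_towerE1_of_base (towerE1_of_cmpTwoLoop hC) hBASE

/-! ## §2 The femto-time sandwich (pure arithmetic) -/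

/-- Two time extents `F, T` pinned to `s` within `δ ≤ ηs/8` by one clock `c ≥ 0`, with `F` pinned to `[s, s+u]` by a second clock `u ≤ ηs/4`,
give `(1−η)s ≤ T·u ≤ (1+η)s`. [folklore] -/
theorem time_sandwich {s η δ u c F T : ℝ} (hs : 0 < s) (hη : 0 < η) (hη1 : η ≤ 1) (hδ : 0 < δ) (hδle : δ ≤ η * s / 8)
    (hu : 0 < u) (hule : u ≤ η * s / 4) (hc : 0 ≤ c) (hF1 : s ≤ F * u) (hF2 : F * u ≤ s + u) (hFc : |F * c - s| ≤ δ) (hTc : |T * c - s| ≤ δ) :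
    (1 - η) * s ≤ T * u ∧ T * u ≤ (1 + η) * s := by
  obtain ⟨hFc1, hFc2⟩ := abs_le.mp hFc
  obtain ⟨hTc1, hTc2⟩ := abs_le.mp hTc
  have hδs : δ < s := by nlinarith
  -- the calibrated clock is positive
  have hcpos : 0 < c := lt_of_le_of_ne hc (by rintro rfl; rw [mul_zero] at hFc1; linarith)
  have hsd : 0 < s - δ := by linarith
  constructor
  · -- lower: F c ≤ s + δ, T c ≥ s − δ ⇒ F (s−δ) ≤ T (s+δ) ⇒ s(s−δ) ≤ F u (s−δ) ≤ T u (s+δ); and (1−η)(s+δ) ≤ s−δ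
    have h2 : F * (s - δ) ≤ T * (s + δ) :=
      le_of_mul_le_mul_right (by nlinarith : F * (s - δ) * c ≤ T * (s + δ) * c) hcpos
    have h3 : F * u * (s - δ) ≤ T * u * (s + δ) := by nlinarith
    have h4 : s * (s - δ) ≤ T * u * (s + δ) := le_trans (by nlinarith) h3
    have h5 : (1 - η) * (s + δ) ≤ s - δ := by nlinarith
    have h6 : (1 - η) * s * (s + δ) ≤ T * u * (s + δ) := by nlinarith
    have hsp : 0 < s + δ := by linarith
    nlinarith
  · -- upper: T c ≤ s + δ, F c ≥ s − δ ⇒ T (s−δ) ≤ F (s+δ) ⇒ T u (s−δ) ≤ (s+u)(s+δ) ≤ (1+η) s (s−δ)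
    have h2 : T * (s - δ) ≤ F * (s + δ) :=
      le_of_mul_le_mul_right (by nlinarith : T * (s - δ) * c ≤ F * (s + δ) * c) hcpos
    have h3 : T * u * (s - δ) ≤ F * u * (s + δ) := by nlinarith
    have h4 : T * u * (s - δ) ≤ (s + u) * (s + δ) := h3.trans (by nlinarith)
    have h5 : (s + u) * (s + δ) ≤ (1 + η) * s * (s - δ) := by
      have a1 : s * δ ≤ s * (η * s / 8) := mul_le_mul_of_nonneg_left hδle hs.le
      have a2 : u * s ≤ η * s / 4 * s := mul_le_mul_of_nonneg_right hule hs.le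
      have a3 : u * δ ≤ η * s / 4 * (η * s / 8) := mul_le_mul hule hδle hδ.le (by positivity)
      have a4 : η * s * δ ≤ η * s * (η * s / 8) := mul_le_mul_of_nonneg_left hδle (by positivity)
      have a5 : η * η * (s * s) ≤ η * (s * s) := mul_le_mul_of_nonneg_right (by nlinarith) (by positivity)
      nlinarith
    nlinarith

/-- ★ **Femto-time sandwich in the window.**  In a femto window of depth `lam ≤ ηs/8` (`0 < η ≤ 1/2`), if some clock value `C ≥ 0` pins both the
label's step count `femtoSteps s β L` and a time extent `T` to `s` within `δ ≤ ηs/8` (`|F·C/L − s| ≤ δ`, `|T·C/L − s| ≤ δ`), then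
`femtoSteps ((1−η)s) β L ≤ T ≤ femtoSteps ((1+η)s) β L` and the lower count is `≥ 2`. [folklore] -/
theorem steps_sandwich {s η δ lam β C : ℝ} {L : ℕ} [NeZero L] {T : ℕ} (hs : 0 < s) (hη : 0 < η) (hη2 : η ≤ 1 / 2)
    (hδ : 0 < δ) (hδle : δ ≤ η * s / 8) (hlam : 0 < lam) (hlamle : lam ≤ η * s / 8) (hW : InFemtoWindow lam β L) (hC : 0 ≤ C)
    (hF : |(femtoSteps s β L : ℝ) * C / L - s| ≤ δ) (hT : |(T : ℝ) * C / L - s| ≤ δ) :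
    femtoSteps ((1 - η) * s) β L ≤ T ∧ T ≤ femtoSteps ((1 + η) * s) β L ∧ 2 ≤ femtoSteps ((1 - η) * s) β L := by
  have hL : (0 : ℝ) < (L : ℝ) := by exact_mod_cast Nat.pos_of_ne_zero (NeZero.ne L)
  have hl : 0 < luscherLambda β L := luscherLambda_pos_of_window hlam hW
  set u : ℝ := luscherLambda β L / L with hu_def
  have hu : 0 < u := Base.unit_pos_of_window hlam hW
  have hule' : u ≤ 2 * lam := Base.unit_le_of_window hlam hW
  have hule : u ≤ η * s / 4 := by linarith
  obtain ⟨hF1, hF2⟩ := Base.femtoSteps_mul_unit hs.le hlam hW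
  have hc : 0 ≤ C / L := div_nonneg hC hL.le
  have eF : (femtoSteps s β L : ℝ) * C / L = (femtoSteps s β L : ℝ) * (C / L) := mul_div_assoc _ _ _
  have eT : (T : ℝ) * C / L = (T : ℝ) * (C / L) := mul_div_assoc _ _ _
  rw [eF] at hF
  rw [eT] at hT
  obtain ⟨hlo, hhi⟩ := time_sandwich hs hη (by linarith) hδ hδle hu hule hc hF1 hF2 hF hT
  -- convert `T·u` bounds into step-count bounds (`u = Λ/L`, `femtoSteps x β L = ⌈x·L/Λ⌉₊`)
  have e_div : ∀ x : ℝ, x * L / luscherLambda β L = x / u := by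
    intro x; rw [hu_def]; field_simp
  refine ⟨?_, ?_, ?_⟩
  · unfold femtoSteps
    refine Nat.ceil_le.mpr ?_
    rw [e_div, div_le_iff₀ hu]
    exact hlo
  · have h1 : (T : ℝ) ≤ (1 + η) * s * L / luscherLambda β L := by
      rw [e_div, le_div_iff₀ hu]; exact hhi
    unfold femtoSteps
    exact_mod_cast h1.trans (Nat.le_ceil _)
  · have h1 : (1 : ℝ) < (1 - η) * s * L / luscherLambda β L := by
      rw [e_div, lt_div_iff₀ hu]
      nlinarith
    have h2 : 1 < femtoSteps ((1 - η) * s) β L := by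
      unfold femtoSteps
      exact Nat.lt_ceil.mpr (by exact_mod_cast h1)
    omega

/-! ## §3 ★ UFTL ∧ S-BASE ⇒ CMP-2LOOP (every two-loop calibrator) -/

/-- Calibrated couplings are large: `1/(4lam³) ≤ x̂` and `|x̂ − 2β₁| ≤ δ·2β₁` with `lam ≤ 1`, `lam ≤ 1/(8(1+δ)B)`, `0 < B` give `B ≤ β₁`. [folklore] -/
theorem beta1_ge_of_calibrated {lam δ x β₁ B : ℝ} (hlam : 0 < lam) (hlam1 : lam ≤ 1) (hδ : 0 < δ) (hB : 0 < B)
    (hle : lam ≤ 1 / (8 * (1 + δ) * B)) (hx : 1 / (4 * lam ^ 3) ≤ x) (hmis : |x - 2 * β₁| ≤ δ * (2 * β₁)) : B ≤ β₁ := by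
  have h2 : x ≤ (1 + δ) * (2 * β₁) := by linarith [(abs_le.mp hmis).2]
  have hl3 : lam ^ 3 ≤ lam := by nlinarith [pow_le_one₀ hlam.le hlam1 (n := 2)]
  have hprod : lam * (8 * (1 + δ) * B) ≤ 1 := by rwa [le_div_iff₀ (by positivity)] at hle
  -- 1/(4lam³) ≥ 1/(4lam) ≥ 2(1+δ)B
  have h3 : 2 * (1 + δ) * B ≤ 1 / (4 * lam ^ 3) := by
    rw [le_div_iff₀ (by positivity)]
    nlinarith [mul_le_mul_of_nonneg_left hl3 (by positivity : (0 : ℝ) ≤ 8 * (1 + δ) * B)]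
  nlinarith

/-- ★ **UFTL ∧ S-BASE ⇒ CMP-2LOOP** (conclusion = the registered XL stub text `TwoLattice.Stmt.stub_cmpTwoLoop` of skeleton rev 3, for EVERY
calibrator obeying the two-loop law; hypotheses = the `lam`-uniform femto trace law UFTL and the verbatim body of S-BASE).  Proof: module
docstring §3 (continuity of `r_𝔥`, UFTL at the two neighbouring femto times, TRACK at a label-matched base coupling for the calibrated clock,
the femto-time sandwich, monotonicity of the trace ratio in `T`, S-BASE on the finitely many bases `b < M²`). [folklore] -/
theorem cmpTwoLoop_of_uniform_of_base
    (hU : ∀ s : ℝ, 0 < s → ∀ ε : ℝ, 0 < ε → ∃ L0 : ℕ, ∃ lam0 : ℝ, 0 < lam0 ∧ ∀ lam : ℝ, 0 < lam → lam ≤ lam0 →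
      ∀ (L : ℕ) [NeZero L], L0 ≤ L → ∀ β : ℝ, InFemtoWindow lam β L →
        |traceRatio L β (femtoSteps s β L) - hTraceRatio s| ≤ ε)
    (hBASE : ∀ (L1 : ℕ) [NeZero L1] (s : ℝ), 0 < s → ∀ ε : ℝ, 0 < ε → ∃ β1 : ℝ, ∀ β : ℝ, β1 ≤ β →
      |traceRatio L1 β (femtoSteps s β L1) - hTraceRatio s| ≤ ε) :
    Stmt.stub_cmpTwoLoop := by
  intro s hs ε hε
  -- continuity of the target at `s`: a relative time shift `η ≤ 1/2` with `r_𝔥((1∓η)s)` within `ε/4` of `r_𝔥(s)`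
  obtain ⟨δc, hδc, hcont⟩ := Metric.continuousAt_iff.mp (continuousAt_hTraceRatio hs) (ε / 4) (by positivity)
  obtain ⟨η, hη0, hη2, hηs⟩ : ∃ η : ℝ, 0 < η ∧ η ≤ 1 / 2 ∧ η * s < δc := by
    refine ⟨min (δc / (2 * s)) (1 / 2), by positivity, min_le_right _ _, ?_⟩
    calc min (δc / (2 * s)) (1 / 2) * s ≤ δc / (2 * s) * s := mul_le_mul_of_nonneg_right (min_le_left _ _) hs.le
      _ = δc / 2 := by field_simp
      _ < δc := by linarith
  have hs1 : 0 < (1 - η) * s := by nlinarith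
  have hs2 : 0 < (1 + η) * s := by positivity
  have hr1 : |hTraceRatio ((1 - η) * s) - hTraceRatio s| < ε / 4 := by
    have h := hcont (x := (1 - η) * s)
      (by rw [Real.dist_eq, show (1 - η) * s - s = -(η * s) by ring, abs_neg, abs_of_pos (by positivity)]; exact hηs)
    rwa [Real.dist_eq] at h
  have hr2 : |hTraceRatio ((1 + η) * s) - hTraceRatio s| < ε / 4 := by
    have h := hcont (x := (1 + η) * s)
      (by rw [Real.dist_eq, show (1 + η) * s - s = η * s by ring, abs_of_pos (by positivity)]; exact hηs)
    rwa [Real.dist_eq] at h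
  -- UFTL at the two neighbouring times
  obtain ⟨LA, lamA, hlamA, HA⟩ := hU ((1 - η) * s) hs1 (ε / 4) (by positivity)
  obtain ⟨LB, lamB, hlamB, HB⟩ := hU ((1 + η) * s) hs2 (ε / 4) (by positivity)
  -- the base scale and the tolerance
  set M : ℕ := max 2 (max LA LB) with hM_def
  have hM : 2 ≤ M := le_max_left _ _
  have hMA : LA ≤ M ^ 2 := ((le_max_left _ _).trans (le_max_right 2 _)).trans (Nat.le_self_pow two_ne_zero M)
  have hMB : LB ≤ M ^ 2 := ((le_max_right _ _).trans (le_max_right 2 _)).trans (Nat.le_self_pow two_ne_zero M)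
  set δ : ℝ := η * s / 8 with hδ_def
  have hδ : 0 < δ := by positivity
  refine ⟨M, hM, δ, hδ, fun φ hφ => ?_⟩
  -- TRACK for this calibrator
  obtain ⟨lam1, hlam1, H1⟩ := TwoLattice.stub_labelTracking M hM δ hδ s hs φ hφ
  -- S-BASE thresholds, uniformly over the finite base range (stated for every `b`, vacuous at `b = 0`)
  have hB : ∀ b : ℕ, ∃ β1 : ℝ, ∀ (hb : NeZero b) (β : ℝ), β1 ≤ β →
      |traceRatio b β (femtoSteps s β b) - hTraceRatio s| ≤ ε / 2 := by
    intro b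
    by_cases hb0 : b = 0
    · exact ⟨0, fun hb => absurd hb0 hb.ne⟩
    · haveI : NeZero b := ⟨hb0⟩
      obtain ⟨β1, h⟩ := hBASE b s hs (ε / 2) (by positivity)
      exact ⟨β1, fun _ β hβ => h β hβ⟩
  choose β1 hβ1 using hB
  set βstar : ℝ := ∑ b ∈ Finset.range (M ^ 2), max (β1 b) 0 with hβstar
  have hβ1le : ∀ b : ℕ, b < M ^ 2 → β1 b ≤ βstar := fun b hb =>
    (le_max_left _ _).trans
      (Finset.single_le_sum (f := fun b => max (β1 b) 0) (fun i _ => le_max_right _ _) (Finset.mem_range.mpr hb))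
  set Bst : ℝ := max βstar 1 with hBst
  have hBst1 : 1 ≤ Bst := le_max_right _ _
  have hBpos : 0 < Bst := lt_of_lt_of_le one_pos hBst1
  -- the depth
  refine ⟨min (min (min lam1 lamA) (min lamB (1 / 2))) (min (η * s / 8) (1 / (8 * (1 + δ) * Bst))),
    lt_min (lt_min (lt_min hlam1 hlamA) (lt_min hlamB (by norm_num))) (lt_min (by positivity) (by positivity)), ?_⟩
  intro lam hlam hle L _ hL β hW b k _ hMb hbM hkL hLk hx β₁ hβ₁ hmis T hT
  have hl1 : lam ≤ lam1 := hle.trans ((min_le_left _ _).trans ((min_le_left _ _).trans (min_le_left _ _)))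
  have hlA : lam ≤ lamA := hle.trans ((min_le_left _ _).trans ((min_le_left _ _).trans (min_le_right _ _)))
  have hlB : lam ≤ lamB := hle.trans ((min_le_left _ _).trans ((min_le_right _ _).trans (min_le_left _ _)))
  have hlhalf : lam ≤ 1 / 2 := hle.trans ((min_le_left _ _).trans ((min_le_right _ _).trans (min_le_right _ _)))
  have hlη : lam ≤ η * s / 8 := hle.trans ((min_le_right _ _).trans (min_le_left _ _))
  have hlB' : lam ≤ 1 / (8 * (1 + δ) * Bst) := hle.trans ((min_le_right _ _).trans (min_le_right _ _))
  have hlone : lam ≤ 1 := by linarith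
  -- a label-matched base coupling exists; TRACK pins the label's step count in calibrated units
  obtain ⟨β₁', hβ₁'1, hmatch⟩ :=
    Tower.exists_matched b (v := invRunningCoupling β L) (Tower.one_le_invRunningCoupling_of_window hlam hlhalf hW)
  obtain ⟨-, -, hiii⟩ := H1 lam hlam hl1 L hL β hW b k hMb hbM hkL hLk β₁' hβ₁'1 hmatch
  -- the calibrated clock value is non-negative (an `rpow` of a `max … 0`)
  have hC : 0 ≤ calLambda φ β (k + 1) b := by
    unfold calLambda luscherLambda
    exact Real.rpow_nonneg (le_max_right _ _) _
  -- femto-time sandwich and the fine side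
  obtain ⟨hlo, hhi, h2⟩ := steps_sandwich hs hη0 hη2 hδ le_rfl hlam hlη hW hC hiii hT
  have m1 := traceRatio_mono L hW.1 h2 hlo
  have m2 := traceRatio_mono L hW.1 (h2.trans hlo) hhi
  have eA := abs_le.mp (HA lam hlam hlA L (hMA.trans hL) β hW)
  have eB := abs_le.mp (HB lam hlam hlB L (hMB.trans hL) β hW)
  have f1 := abs_lt.mp hr1
  have f2 := abs_lt.mp hr2
  have hfine : |traceRatio L β T - hTraceRatio s| ≤ ε / 2 := by
    rw [abs_le]; constructor <;> linarith
  -- the base side: the calibrated `β₁` clears the S-BASE threshold of `b`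
  have hβ₁B : Bst ≤ β₁ := beta1_ge_of_calibrated hlam hlone hδ hBpos hlB' hx hmis
  have hβ₁ge : β1 b ≤ β₁ := ((hβ1le b hbM).trans (le_max_left _ _)).trans hβ₁B
  have hbase := hβ1 b ‹NeZero b› β₁ hβ₁ge
  -- triangle
  calc |traceRatio L β T - traceRatio b β₁ (femtoSteps s β₁ b)|
      = |(traceRatio L β T - hTraceRatio s) + (hTraceRatio s - traceRatio b β₁ (femtoSteps s β₁ b))| := by congr 1; ring
    _ ≤ |traceRatio L β T - hTraceRatio s| + |hTraceRatio s - traceRatio b β₁ (femtoSteps s β₁ b)| := abs_add_le _ _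
    _ ≤ ε := by rw [abs_sub_comm (hTraceRatio s)]; linarith

/-! ## §4 Corollaries modulo S-BASE: CMP-2LOOP ⟺ UFTL ⟺ TOWER-E1 ⟺ S-TOWER; one calibrator suffices -/

/-- ★ **Modulo S-BASE, CMP-2LOOP ⟺ UFTL** (rev 3's XL stub is the `lam`-uniform femto trace law). [folklore] -/
theorem cmpTwoLoop_iff_uniform_of_base
    (hBASE : ∀ (L1 : ℕ) [NeZero L1] (s : ℝ), 0 < s → ∀ ε : ℝ, 0 < ε → ∃ β1 : ℝ, ∀ β : ℝ, β1 ≤ β →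
      |traceRatio L1 β (femtoSteps s β L1) - hTraceRatio s| ≤ ε) :
    Stmt.stub_cmpTwoLoop ↔
    (∀ s : ℝ, 0 < s → ∀ ε : ℝ, 0 < ε → ∃ L0 : ℕ, ∃ lam0 : ℝ, 0 < lam0 ∧ ∀ lam : ℝ, 0 < lam → lam ≤ lam0 →
      ∀ (L : ℕ) [NeZero L], L0 ≤ L → ∀ β : ℝ, InFemtoWindow lam β L →
        |traceRatio L β (femtoSteps s β L) - hTraceRatio s| ≤ ε) :=
  ⟨fun hC => uniform_of_cmpTwoLoop_of_base hC hBASE, fun hU => cmpTwoLoop_of_uniform_of_base hU hBASE⟩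

/-- ★ **Modulo S-BASE, CMP-2LOOP ⟺ rev 2's TOWER-E1** (`→` needs no S-BASE: `towerE1_of_cmpTwoLoop`; `←`: TOWER-E1 ∧ S-BASE ⇒ UFTL ⇒ CMP). [folklore] -/
theorem cmpTwoLoop_iff_towerE1_of_base
    (hBASE : ∀ (L1 : ℕ) [NeZero L1] (s : ℝ), 0 < s → ∀ ε : ℝ, 0 < ε → ∃ β1 : ℝ, ∀ β : ℝ, β1 ≤ β →
      |traceRatio L1 β (femtoSteps s β L1) - hTraceRatio s| ≤ ε) :
    Stmt.stub_cmpTwoLoop ↔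
    (∀ s : ℝ, 0 < s → ∀ ε : ℝ, 0 < ε → ∃ M : ℕ, 2 ≤ M ∧ ∃ lam0 : ℝ, 0 < lam0 ∧ ∀ lam : ℝ, 0 < lam → lam ≤ lam0 →
      ∀ (L : ℕ) [NeZero L], M ^ 2 ≤ L → ∀ β : ℝ, InFemtoWindow lam β L →
        ∀ (b k : ℕ) [NeZero b], M ≤ b → b < M ^ 2 → b * M ^ (k + 1) ≤ L → L < b * M ^ k * (M + 1) →
          ∀ β₁ : ℝ, 1 ≤ β₁ → invRunningCoupling β₁ b = invRunningCoupling β L →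
            |traceRatio L β (femtoSteps s β L) - traceRatio b β₁ (femtoSteps s β₁ b)| ≤ ε) :=
  ⟨fun hC => towerE1_of_cmpTwoLoop hC,
    fun hE1 => cmpTwoLoop_of_uniform_of_base (Tower.uniform_of_towerE1_of_base hE1 hBASE) hBASE⟩

/-- ★ **Modulo S-BASE, CMP-2LOOP ⟺ rev 1's all-pairs S-TOWER** (verbatim body of the rev-1 registered `Stmt.stub_twoLatticeUniversality`; tree
`Tower.twoLatticeUniversality_of_uniform` / `Tower.uniform_of_twoLattice_of_base`).  So the XL stubs of revs 1, 2, 3 coincide modulo S-BASE. [folklore] -/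
theorem cmpTwoLoop_iff_twoLatticeUniversality_of_base
    (hBASE : ∀ (L1 : ℕ) [NeZero L1] (s : ℝ), 0 < s → ∀ ε : ℝ, 0 < ε → ∃ β1 : ℝ, ∀ β : ℝ, β1 ≤ β →
      |traceRatio L1 β (femtoSteps s β L1) - hTraceRatio s| ≤ ε) :
    Stmt.stub_cmpTwoLoop ↔
    (∀ s : ℝ, 0 < s → ∀ ε : ℝ, 0 < ε → ∃ L0 : ℕ, ∃ lam0 : ℝ, 0 < lam0 ∧ ∀ lam : ℝ, 0 < lam → lam ≤ lam0 →
      ∀ (L1 : ℕ) [NeZero L1], L0 ≤ L1 → ∀ (L : ℕ) [NeZero L], L1 ≤ L → ∀ β : ℝ, InFemtoWindow lam β L →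
        ∀ β₁ : ℝ, 1 ≤ β₁ → invRunningCoupling β₁ L1 = invRunningCoupling β L →
          |traceRatio L β (femtoSteps s β L) - traceRatio L1 β₁ (femtoSteps s β₁ L1)| ≤ ε) :=
  ⟨fun hC => Tower.twoLatticeUniversality_of_uniform (uniform_of_cmpTwoLoop_of_base hC hBASE),
    fun hT => cmpTwoLoop_of_uniform_of_base (Tower.uniform_of_twoLattice_of_base hT hBASE) hBASE⟩

/-- ★ **One calibrator suffices (modulo S-BASE).**  The text of `Stmt.stub_cmpTwoLoop` with `∀ φ, twoLoopLawH … φ → ∃ lam0 …` weakened to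
`∃ φ, twoLoopLawH … φ ∧ ∃ lam0 …` (CMP-2LOOP asserted for SOME lawful calibrator at the chosen `M`) implies, given S-BASE, the registered text for
EVERY lawful calibrator: TRACK at that calibrator gives TOWER-E1, TOWER-E1 ∧ S-BASE gives UFTL, and §3 returns CMP-2LOOP.  The calibrator interface
is decoration modulo S-BASE. [folklore] -/
theorem cmpTwoLoop_of_cmpSome_of_base
    (hSome : ∀ s : ℝ, 0 < s → ∀ ε : ℝ, 0 < ε → ∃ M : ℕ, 2 ≤ M ∧ ∃ δ : ℝ, 0 < δ ∧
      ∃ φ : FlowStep.HBeta, Stmt.twoLoopLawH (B12Normalization.stepBal 2 M) (twoLoopStepBal M) φ ∧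
        ∃ lam0 : ℝ, 0 < lam0 ∧ ∀ lam : ℝ, 0 < lam → lam ≤ lam0 →
          ∀ (L : ℕ) [NeZero L], M ^ 2 ≤ L → ∀ β : ℝ, InFemtoWindow lam β L →
            ∀ (b k : ℕ) [NeZero b], M ≤ b → b < M ^ 2 → b * M ^ (k + 1) ≤ L → L < b * M ^ k * (M + 1) →
              1 / (4 * lam ^ 3) ≤ flowInvSq φ β (k + 1) →
              ∀ β₁ : ℝ, 1 ≤ β₁ → |flowInvSq φ β (k + 1) - 2 * β₁| ≤ δ * (2 * β₁) →
                ∀ T : ℕ, |(T : ℝ) * calLambda φ β (k + 1) b / L - s| ≤ δ →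
                  |traceRatio L β T - traceRatio b β₁ (femtoSteps s β₁ b)| ≤ ε)
    (hBASE : ∀ (L1 : ℕ) [NeZero L1] (s : ℝ), 0 < s → ∀ ε : ℝ, 0 < ε → ∃ β1 : ℝ, ∀ β : ℝ, β1 ≤ β →
      |traceRatio L1 β (femtoSteps s β L1) - hTraceRatio s| ≤ ε) :
    Stmt.stub_cmpTwoLoop := by
  -- TOWER-E1 from CMP at the given calibrator + TRACK at the same calibrator
  have hE1 : ∀ s : ℝ, 0 < s → ∀ ε : ℝ, 0 < ε → ∃ M : ℕ, 2 ≤ M ∧ ∃ lam0 : ℝ, 0 < lam0 ∧ ∀ lam : ℝ, 0 < lam → lam ≤ lam0 →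
      ∀ (L : ℕ) [NeZero L], M ^ 2 ≤ L → ∀ β : ℝ, InFemtoWindow lam β L →
        ∀ (b k : ℕ) [NeZero b], M ≤ b → b < M ^ 2 → b * M ^ (k + 1) ≤ L → L < b * M ^ k * (M + 1) →
          ∀ β₁ : ℝ, 1 ≤ β₁ → invRunningCoupling β₁ b = invRunningCoupling β L →
            |traceRatio L β (femtoSteps s β L) - traceRatio b β₁ (femtoSteps s β₁ b)| ≤ ε := by
    intro s hs ε hε
    obtain ⟨M, hM, δ, hδ, φ, hφ, lam0, hlam0, hc⟩ := hSome s hs ε hε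
    obtain ⟨lam1, hlam1, ht⟩ := TwoLattice.stub_labelTracking M hM δ hδ s hs φ hφ
    refine ⟨M, hM, min lam0 lam1, lt_min hlam0 hlam1, ?_⟩
    intro lam hlam hle L _ hL β hW b k _ hMb hbM hkL hLk β₁ hβ₁ hmatch
    obtain ⟨hwin, hmis, htime⟩ := ht lam hlam (hle.trans (min_le_right _ _)) L hL β hW b k hMb hbM hkL hLk β₁ hβ₁ hmatch
    exact hc lam hlam (hle.trans (min_le_left _ _)) L hL β hW b k hMb hbM hkL hLk hwin β₁ hβ₁ hmis (femtoSteps s β L) htime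
  exact cmpTwoLoop_of_uniform_of_base (Tower.uniform_of_towerE1_of_base hE1 hBASE) hBASE

end R3

end Summit.QuantumFields.YangMills.Theorems.TwistedTraceScaling.Negative

end
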